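import Literature.NumberTheory.EllipticCurves.TwoIsogenyDescentIndex
import Literature.NumberTheory.EllipticCurves.TwoIsogenySelmerGroupRankProofs
import Literature.NumberTheory.EllipticCurves.BSDInvariantsProofs
import HarnessLib

/-!
# Planted rank `≥ 2` through the `2`-isogeny descent count, and p2's `8-15-17` family (cell `bsd-rank2`)

Cell `bsd-rank2` (D-0036), seat `bsd-rank2-lit` GEN 14, for planner p2 GEN 13's door (F*)
(memo `run/shared/lean/pub/bsd-rank2/p2/PADIC-R2-G13.md` §3, sketch `p2/g13/routeF/Sketch.lean`, support
item `FamilyFacts` = K_F1, conjunct «Mordell–Weil rank `≥ 2`»; §5 ask (3) "type K_F1 against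
`Zywina2025RankTwo.lean`'s API").

PARTITION: none — r_an ≥ 2, summit axis S0; TWIN (D-0056): n/a. B1: member-wise Mordell–Weil bookkeeping
(explicit points + the tree's descent count); nothing family-infinite, no L-function, no S0 motion.

## Contents

§1 A GENERAL KERNEL for Zywina-type plantings on `E = E_{a,b} : y² = x³ + a x² + b x`: the tree's exact
count `#α(E(ℚ)) · #α(E'(ℚ)) = 2^{rank + 2}` (`WeierstrassCurve.natCard_range_xSqClass_mul`,
`TwoIsogenyDescentIndex.lean`; Silverman–Tate §3.6) turns «`2^i` classes in `α(E(ℚ))` and `2^j` classes in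
`α(E'(ℚ))`» into `i + j ≤ rank + 2` (`add_le_mordellWeilRank_add_two_of_card_le`), in particular four and
four give `2 ≤ rank` (`two_le_mordellWeilRank_of_four_classes`); and ONE integral point `(x, y)` with
`x ≠ 0`, `[x] ∉ {1, [b]}`, `[b] ≠ 1` already gives the four classes `{1, [b], [x], [b][x]}`
(`exists_four_classes_of_point`).

§2 THE `8-15-17` FAMILY (p2 GEN 13): `q = m + 64 n²`, `r = m + 289 n²` (`m, q, r` prime, `n ≠ 0`),
`E : y² = x³ − 17q x² + 16qr x`, `E' = E_{34q, 225mq}` (`a² − 4b = 289q² − 64qr = 225 mq`). Planted points: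
`P₁ = (q, 60nq)` on `E` (`q³ − 17q³ + 16q²r = 16q²(r − q) = (60nq)²`) and `Q₁ = (−25q, 600nq)` on `E'`
(`(−25q)³ + 34q(25q)² − 225mq·25q = 5625q²(q − m) = (600nq)²`), with classes `[q]`, `[16qr] = [qr]` on `E`
and `[−25q] = [−q]`, `[225mq] = [mq]` on `E'`; so `α(E(ℚ)) ⊇ {1, [q], [r], [qr]}`,
`α(E'(ℚ)) ⊇ {1, [−q], [−m], [mq]}` and **`2 ≤ rank E(ℚ)`** (`two_le_mordellWeilRank_family81517`). This is
the rank conjunct of K_F1 for the integral short model; p2's `curve j n` is the `a₁ = 1` model of the same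
curve (`x = 4X`, `y = 8Y + 4X`), to which the rank transports by the tree's variable-change invariance when
the route is filed.

No named fact, no `sorry`; tree descent API + Mathlib only. (Upper bounds / exact rank are NOT claimed: on the
odd-parity half p2 expects rank `3`.)
-/

namespace Summit.BirchSwinnertonDyer.Rank2

open scoped Classical
open _root_.WeierstrassCurve
open _root_.WeierstrassCurve.Affine (SqUnits sqClass sqClass_mul sqClass_sq sqClass_eq_one_iff
  sqClass_eq_mul_of_mul_mul_eq_sq)
open Literature.NumberTheory.EllipticCurves

/-! ### §1 The general kernel -/

/-- **Descent count ⇒ rank lower bound.** If `α(E(ℚ))` contains a finite set of `≥ 2^i` square classes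
and `α(E'(ℚ))` one of `≥ 2^j`, then `i + j ≤ rank E(ℚ) + 2`. [folklore: Silverman–Tate §3.6] -/
theorem add_le_mordellWeilRank_add_two_of_card_le (W : WeierstrassCurve ℚ) [W.IsTwoTorsionNF]
    [W.IsElliptic] {S S' : Finset (SqUnits ℚ)} (hS : (S : Set (SqUnits ℚ)) ⊆ Set.range W.xSqClass)
    (hS' : (S' : Set (SqUnits ℚ)) ⊆ Set.range W.twoIsogenyCodomain.xSqClass) {i j : ℕ}
    (hi : 2 ^ i ≤ S.card) (hj : 2 ^ j ≤ S'.card) : i + j ≤ W.mordellWeilRank + 2 := by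
  have key := natCard_range_xSqClass_mul W
  -- both images are finite (their cardinal product is a power of two)
  have hne : Nat.card (Set.range W.xSqClass) ≠ 0 := by
    intro h0; rw [h0, zero_mul] at key; exact absurd key.symm (pow_ne_zero _ two_ne_zero)
  have hne' : Nat.card (Set.range W.twoIsogenyCodomain.xSqClass) ≠ 0 := by
    intro h0; rw [h0, mul_zero] at key; exact absurd key.symm (pow_ne_zero _ two_ne_zero)
  have hfin : (Set.range W.xSqClass).Finite := Nat.finite_of_card_ne_zero hne
  have hfin' : (Set.range W.twoIsogenyCodomain.xSqClass).Finite := Nat.finite_of_card_ne_zero hne'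
  have h1 : S.card ≤ Nat.card (Set.range W.xSqClass) := by
    rw [Nat.card_coe_set_eq, ← Set.ncard_coe_finset]
    exact Set.ncard_le_ncard hS hfin
  have h2 : S'.card ≤ Nat.card (Set.range W.twoIsogenyCodomain.xSqClass) := by
    rw [Nat.card_coe_set_eq, ← Set.ncard_coe_finset]
    exact Set.ncard_le_ncard hS' hfin'
  have hle : 2 ^ (i + j) ≤ 2 ^ (W.mordellWeilRank + 2) := by
    rw [pow_add, ← key]
    exact Nat.mul_le_mul (le_trans hi h1) (le_trans hj h2)
  exact (Nat.pow_le_pow_iff_right (by norm_num)).mp hle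

/-- Four classes on each side give `rank ≥ 2`. [folklore: Silverman–Tate §3.6] -/
theorem two_le_mordellWeilRank_of_four_classes (W : WeierstrassCurve ℚ) [W.IsTwoTorsionNF]
    [W.IsElliptic] {S S' : Finset (SqUnits ℚ)} (hS : (S : Set (SqUnits ℚ)) ⊆ Set.range W.xSqClass)
    (hS' : (S' : Set (SqUnits ℚ)) ⊆ Set.range W.twoIsogenyCodomain.xSqClass)
    (h4 : 4 ≤ S.card) (h4' : 4 ≤ S'.card) : 2 ≤ W.mordellWeilRank := by
  have := add_le_mordellWeilRank_add_two_of_card_le W hS hS' (i := 2) (j := 2)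
    (by simpa using h4) (by simpa using h4')
  omega

/-- In `ℚ*/ℚ*²`: four pairwise products `{1, u, v, u·v}` of two classes `u, v ≠ 1`, `u ≠ v`, are four
distinct classes. [folklore] -/
theorem card_four_of_ne {u v : SqUnits ℚ} (hu : u ≠ 1) (hv : v ≠ 1) (huv : u ≠ v) :
    ({1, u, v, u * v} : Finset (SqUnits ℚ)).card = 4 := by
  have h1 : u * v ≠ 1 := by
    intro h
    apply huv
    have := Affine.SqUnits.eq_mul_of_mul_eq h
    rw [Affine.SqUnits.one_mul] at this
    exact this
  have h2 : u * v ≠ u := by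
    intro h
    apply hv
    have : u * v = u * 1 := by rw [h, mul_one]
    exact mul_left_cancel this
  have h3 : u * v ≠ v := by
    intro h
    apply hu
    have : u * v = 1 * v := by rw [h, one_mul]
    exact mul_right_cancel this
  rw [Finset.card_insert_of_notMem, Finset.card_insert_of_notMem, Finset.card_pair h3.symm]
  · simp only [Finset.mem_insert, Finset.mem_singleton, not_or]
    exact ⟨huv, h2.symm⟩
  · simp only [Finset.mem_insert, Finset.mem_singleton, not_or]
    exact ⟨hu.symm, hv.symm, h1.symm⟩

/-- **One planted point gives four classes.** On `E = E_{a,b}` (`a, b ∈ ℤ`, `b(a² − 4b) ≠ 0`), an integral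
point `(x, y)` with `x ≠ 0` and classes `[x] ≠ 1`, `[b] ≠ 1`, `[x] ≠ [b]` yields the four classes
`{1, [b], [x], [b]·[x]} ⊆ α(E(ℚ))` (from `O`, `T = (0,0)`, `P = (x,y)`, `T + P`). [folklore: Silverman–Tate §3.5] -/
theorem exists_four_classes_of_point {a b x y : ℤ} (hab : b * (a ^ 2 - 4 * b) ≠ 0) (hx : x ≠ 0)
    (heq : y ^ 2 = x ^ 3 + a * x ^ 2 + b * x) (h1 : sqClass ((x : ℤ) : ℚ) ≠ 1)
    (h2 : sqClass ((b : ℤ) : ℚ) ≠ 1) (h3 : sqClass ((b : ℤ) : ℚ) ≠ sqClass ((x : ℤ) : ℚ)) :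
    ∃ S : Finset (SqUnits ℚ),
      (S : Set (SqUnits ℚ)) ⊆ Set.range (⟨0, (a : ℚ), 0, (b : ℚ), 0⟩ : WeierstrassCurve ℚ).xSqClass ∧
        S.card = 4 := by
  haveI := isElliptic_mk_of_ne_zero (F := ℚ) hab
  set E : WeierstrassCurve ℚ := ⟨0, (a : ℚ), 0, (b : ℚ), 0⟩ with hE
  refine ⟨{1, sqClass ((b : ℤ) : ℚ), sqClass ((x : ℤ) : ℚ), sqClass ((b : ℤ) : ℚ) * sqClass ((x : ℤ) : ℚ)},
    ?_, card_four_of_ne h2 h1 h3⟩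
  have hO : (1 : SqUnits ℚ) ∈ Set.range E.xSqClass := ⟨0, xSqClass_zero E⟩
  have hT : sqClass ((b : ℤ) : ℚ) ∈ Set.range E.xSqClass :=
    ⟨E.twoTorsionPoint, by rw [xSqClass_twoTorsionPoint]⟩
  have hP : sqClass ((x : ℤ) : ℚ) ∈ Set.range E.xSqClass := by
    have heqQ : E.toAffine.Equation ((x : ℤ) : ℚ) ((y : ℤ) : ℚ) := by
      rw [equation_iff_of_isTwoTorsionNF]
      show ((y : ℤ) : ℚ) ^ 2 = ((x : ℤ) : ℚ) ^ 3 + (a : ℚ) * ((x : ℤ) : ℚ) ^ 2 + (b : ℚ) * ((x : ℤ) : ℚ)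
      exact_mod_cast heq
    refine ⟨.some _ _ ((Affine.equation_iff_nonsingular).mp heqQ), ?_⟩
    exact xSqClass_some_of_ne_zero _ (by exact_mod_cast hx)
  have hTP : sqClass ((b : ℤ) : ℚ) * sqClass ((x : ℤ) : ℚ) ∈ Set.range E.xSqClass :=
    mul_mem_range_xSqClass E hT hP
  intro c hc
  simp only [Finset.coe_insert, Finset.coe_singleton, Set.mem_insert_iff, Set.mem_singleton_iff] at hc
  rcases hc with rfl | rfl | rfl | rfl
  · exact hO
  · exact hT
  · exact hP
  · exact hTP

/-! ### Square classes of squarefree integers (local copies of folklore helpers) -/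

/-- Squarefree integers with the same class in `ℚ*/ℚ*²` are equal. [folklore] -/
theorem eq_of_sqClass_intCast_eq {d₁ d₂ : ℤ} (h₁ : Squarefree d₁) (h₂ : Squarefree d₂)
    (he : sqClass (d₁ : ℚ) = sqClass (d₂ : ℚ)) : d₁ = d₂ := by
  have h0₁ : (d₁ : ℚ) ≠ 0 := by exact_mod_cast h₁.ne_zero
  have h0₂ : (d₂ : ℚ) ≠ 0 := by exact_mod_cast h₂.ne_zero
  have h1 : sqClass ((d₁ : ℚ) * d₂) = 1 := by rw [sqClass_mul h0₁ h0₂, he, Affine.SqUnits.mul_self]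
  obtain ⟨u, hu⟩ := (sqClass_eq_one_iff (mul_ne_zero h0₁ h0₂)).mp h1
  obtain ⟨k, hk⟩ : IsSquare (d₁ * d₂) := by
    rw [← Rat.isSquare_intCast_iff]
    exact ⟨u, by push_cast; rw [hu, pow_two]⟩
  exact eq_of_squarefree_of_mul_eq_sq h₁ h₂ (m := k) (by rw [hk, pow_two])

/-- Distinct squarefree integers have distinct square classes. [folklore] -/
theorem sqClass_intCast_ne {d₁ d₂ : ℤ} (h₁ : Squarefree d₁) (h₂ : Squarefree d₂) (hne : d₁ ≠ d₂) :
    sqClass (d₁ : ℚ) ≠ sqClass (d₂ : ℚ) := fun he ↦ hne (eq_of_sqClass_intCast_eq h₁ h₂ he)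

/-- A squarefree integer `≠ 1` has non-trivial square class. [folklore] -/
theorem sqClass_intCast_ne_one {d : ℤ} (h : Squarefree d) (hne : d ≠ 1) : sqClass (d : ℚ) ≠ 1 := by
  have := sqClass_intCast_ne h squarefree_one hne
  rwa [Int.cast_one, show sqClass (1 : ℚ) = 1 from (sqClass_eq_one_iff one_ne_zero).mpr ⟨1, by norm_num⟩]
    at this

/-- `[x t²] = [x]`. [folklore] -/
theorem sqClass_mul_sq_intCast {x t : ℤ} (hx : x ≠ 0) (ht : t ≠ 0) :
    sqClass (((x * t ^ 2 : ℤ)) : ℚ) = sqClass ((x : ℤ) : ℚ) := by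
  push_cast
  rw [sqClass_mul (by exact_mod_cast hx) (by positivity), sqClass_sq, Affine.SqUnits.mul_one]

/-- Minus a natural prime is squarefree in `ℤ`. [folklore] -/
theorem squarefree_neg_intCast_of_prime {p : ℕ} (hp : p.Prime) : Squarefree (-(p : ℤ)) :=
  Int.squarefree_natAbs.mp (by simpa using hp.squarefree)

/-- The product of two distinct natural primes is squarefree in `ℤ`. [folklore] -/
theorem squarefree_intCast_mul_of_prime {p q : ℕ} (hp : p.Prime) (hq : q.Prime) (hpq : p ≠ q) :
    Squarefree ((p : ℤ) * q) := by
  refine Int.squarefree_natAbs.mp ?_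
  rw [Int.natAbs_mul, Int.natAbs_natCast, Int.natAbs_natCast,
    Nat.squarefree_mul ((Nat.coprime_primes hp hq).mpr hpq)]
  exact ⟨hp.squarefree, hq.squarefree⟩

/-! ### §2 p2's `8-15-17` family: `E : y² = x³ − 17q x² + 16qr x`, `q = m + 64n²`, `r = m + 289n²` -/

section Family81517

variable {m q r : ℕ} {n : ℤ}

/-- `q ≠ r`, `m ≠ q`, as naturals. [folklore] -/
theorem family81517_ne (hn : n ≠ 0)
    (hq_eq : (q : ℤ) = m + 64 * n ^ 2) (hr_eq : (r : ℤ) = m + 289 * n ^ 2) : q ≠ r ∧ m ≠ q := by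
  have hn2 : 0 < n ^ 2 := by positivity
  constructor
  · intro h; have : (q : ℤ) = r := by exact_mod_cast h
    rw [hq_eq, hr_eq] at this; nlinarith
  · intro h; have : (m : ℤ) = q := by exact_mod_cast h
    rw [hq_eq] at this; nlinarith

/-- `a² − 4b = 225 m q` for `(a, b) = (−17q, 16qr)`. [folklore] -/
theorem family81517_disc (hq_eq : (q : ℤ) = m + 64 * n ^ 2) (hr_eq : (r : ℤ) = m + 289 * n ^ 2) :
    (-17 * (q : ℤ)) ^ 2 - 4 * (16 * q * r) = 225 * m * q := by
  linear_combination 289 * (q : ℤ) * hq_eq - 64 * (q : ℤ) * hr_eq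

/-- `b (a² − 4b) ≠ 0` for `E_{−17q, 16qr}`. [folklore] -/
theorem family81517_hab (hm : m.Prime) (hq : q.Prime) (hr : r.Prime)
    (hq_eq : (q : ℤ) = m + 64 * n ^ 2) (hr_eq : (r : ℤ) = m + 289 * n ^ 2) :
    (16 * q * r : ℤ) * ((-17 * q) ^ 2 - 4 * (16 * q * r)) ≠ 0 := by
  rw [family81517_disc hq_eq hr_eq]
  have : (0 : ℤ) < m := by exact_mod_cast hm.pos
  have : (0 : ℤ) < q := by exact_mod_cast hq.pos
  have : (0 : ℤ) < r := by exact_mod_cast hr.pos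
  positivity

/-- `b' (a'² − 4b') ≠ 0` for `E' = E_{34q, 225mq}` (`a'² − 4b' = 256 q r`). [folklore] -/
theorem family81517_hab' (hm : m.Prime) (hq : q.Prime) (hr : r.Prime)
    (hq_eq : (q : ℤ) = m + 64 * n ^ 2) (hr_eq : (r : ℤ) = m + 289 * n ^ 2) :
    (225 * m * q : ℤ) * ((34 * q) ^ 2 - 4 * (225 * m * q)) ≠ 0 := by
  have hd : (34 * (q : ℤ)) ^ 2 - 4 * (225 * m * q) = 256 * q * r := by
    linear_combination 1156 * (q : ℤ) * hq_eq - 256 * (q : ℤ) * hr_eq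
  rw [hd]
  have : (0 : ℤ) < m := by exact_mod_cast hm.pos
  have : (0 : ℤ) < q := by exact_mod_cast hq.pos
  have : (0 : ℤ) < r := by exact_mod_cast hr.pos
  positivity

/-- The `2`-isogenous curve of `E_{−17q,16qr}` is `E' = E_{34q, 225mq}`. [folklore] -/
theorem family81517_codomain (hq_eq : (q : ℤ) = m + 64 * n ^ 2) (hr_eq : (r : ℤ) = m + 289 * n ^ 2) :
    (⟨0, ((-17 * q : ℤ) : ℚ), 0, ((16 * q * r : ℤ) : ℚ), 0⟩ : WeierstrassCurve ℚ).twoIsogenyCodomain =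
      ⟨0, ((34 * q : ℤ) : ℚ), 0, ((225 * m * q : ℤ) : ℚ), 0⟩ := by
  rw [twoIsogenyCodomain_mk_intCast, family81517_disc hq_eq hr_eq]
  congr 2
  ring

/-- Four classes `{1, [qr], [q], [r]}` in `α(E(ℚ))`, from `T = (0,0)` and the planted point
`P₁ = (q, 60nq)`. [folklore] -/
theorem family81517_four_classes (hm : m.Prime) (hq : q.Prime) (hr : r.Prime) (hn : n ≠ 0)
    (hq_eq : (q : ℤ) = m + 64 * n ^ 2) (hr_eq : (r : ℤ) = m + 289 * n ^ 2) :
    ∃ S : Finset (SqUnits ℚ), (S : Set (SqUnits ℚ)) ⊆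
      Set.range (⟨0, ((-17 * q : ℤ) : ℚ), 0, ((16 * q * r : ℤ) : ℚ), 0⟩ : WeierstrassCurve ℚ).xSqClass ∧
        S.card = 4 := by
  obtain ⟨hqr, hmq⟩ := family81517_ne hn hq_eq hr_eq
  have hq0 : (q : ℤ) ≠ 0 := by exact_mod_cast hq.ne_zero
  have hr0 : (r : ℤ) ≠ 0 := by exact_mod_cast hr.ne_zero
  -- the planted point
  have hpt : (60 * n * q : ℤ) ^ 2 = (q : ℤ) ^ 3 + (-17 * q) * (q : ℤ) ^ 2 + (16 * q * r) * q := by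
    linear_combination (-16 : ℤ) * q ^ 2 * (hr_eq - hq_eq)
  -- the classes: `[16qr] = [qr]`
  have hb : sqClass (((16 * q * r : ℤ)) : ℚ) = sqClass ((((q : ℤ) * r : ℤ)) : ℚ) := by
    rw [show (16 * q * r : ℤ) = (q * r) * 4 ^ 2 by ring]
    exact sqClass_mul_sq_intCast (mul_ne_zero hq0 hr0) (by norm_num)
  have hsq_q : Squarefree (q : ℤ) := (Nat.prime_iff_prime_int.mp hq).squarefree
  have hsq_qr : Squarefree ((q : ℤ) * r) := squarefree_intCast_mul_of_prime hq hr hqr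
  have h1 : sqClass (((q : ℤ)) : ℚ) ≠ 1 :=
    sqClass_intCast_ne_one hsq_q (by exact_mod_cast hq.ne_one)
  have h2 : sqClass (((16 * q * r : ℤ)) : ℚ) ≠ 1 := by
    rw [hb]
    refine sqClass_intCast_ne_one hsq_qr ?_
    have h1q : (1 : ℤ) < q := by exact_mod_cast hq.one_lt
    have h1r : (1 : ℤ) < r := by exact_mod_cast hr.one_lt
    nlinarith
  have h3 : sqClass (((16 * q * r : ℤ)) : ℚ) ≠ sqClass (((q : ℤ)) : ℚ) := by
    rw [hb]
    refine sqClass_intCast_ne hsq_qr hsq_q ?_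
    have h1q : (1 : ℤ) < q := by exact_mod_cast hq.one_lt
    have h1r : (1 : ℤ) < r := by exact_mod_cast hr.one_lt
    nlinarith
  exact exists_four_classes_of_point (family81517_hab hm hq hr hq_eq hr_eq) hq0 hpt h1 h2 h3

/-- Four classes `{1, [mq], [−q], [−m]}` in `α(E'(ℚ))`, from `T' = (0,0)` and the planted point
`Q₁ = (−25q, 600nq)`. [folklore] -/
theorem family81517_four_classes' (hm : m.Prime) (hq : q.Prime) (hr : r.Prime) (hn : n ≠ 0)
    (hq_eq : (q : ℤ) = m + 64 * n ^ 2) (hr_eq : (r : ℤ) = m + 289 * n ^ 2) :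
    ∃ S : Finset (SqUnits ℚ), (S : Set (SqUnits ℚ)) ⊆
      Set.range (⟨0, ((34 * q : ℤ) : ℚ), 0, ((225 * m * q : ℤ) : ℚ), 0⟩ : WeierstrassCurve ℚ).xSqClass ∧
        S.card = 4 := by
  obtain ⟨hqr, hmq⟩ := family81517_ne hn hq_eq hr_eq
  have hq0 : (q : ℤ) ≠ 0 := by exact_mod_cast hq.ne_zero
  have hm0 : (m : ℤ) ≠ 0 := by exact_mod_cast hm.ne_zero
  -- the planted point
  have hpt : (600 * n * q : ℤ) ^ 2 =
      (-25 * q : ℤ) ^ 3 + (34 * q) * (-25 * q : ℤ) ^ 2 + (225 * m * q) * (-25 * q) := by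
    linear_combination (-5625 : ℤ) * q ^ 2 * hq_eq
  -- the classes: `[225mq] = [mq]`, `[−25q] = [−q]`
  have hb : sqClass (((225 * m * q : ℤ)) : ℚ) = sqClass ((((m : ℤ) * q : ℤ)) : ℚ) := by
    rw [show (225 * m * q : ℤ) = (m * q) * 15 ^ 2 by ring]
    exact sqClass_mul_sq_intCast (mul_ne_zero hm0 hq0) (by norm_num)
  have hx : sqClass (((-25 * q : ℤ)) : ℚ) = sqClass (((-(q : ℤ) : ℤ)) : ℚ) := by
    rw [show (-25 * q : ℤ) = (-q) * 5 ^ 2 by ring]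
    exact sqClass_mul_sq_intCast (neg_ne_zero.mpr hq0) (by norm_num)
  have hsq_q : Squarefree (-(q : ℤ)) := squarefree_neg_intCast_of_prime hq
  have hsq_mq : Squarefree ((m : ℤ) * q) := squarefree_intCast_mul_of_prime hm hq hmq
  have h1m : (1 : ℤ) < m := by exact_mod_cast hm.one_lt
  have h1q : (1 : ℤ) < q := by exact_mod_cast hq.one_lt
  have h1 : sqClass (((-25 * q : ℤ)) : ℚ) ≠ 1 := by
    rw [hx]; exact sqClass_intCast_ne_one hsq_q (by omega)
  have h2 : sqClass (((225 * m * q : ℤ)) : ℚ) ≠ 1 := by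
    rw [hb]; exact sqClass_intCast_ne_one hsq_mq (by nlinarith)
  have h3 : sqClass (((225 * m * q : ℤ)) : ℚ) ≠ sqClass (((-25 * q : ℤ)) : ℚ) := by
    rw [hb, hx]; exact sqClass_intCast_ne hsq_mq hsq_q (by nlinarith)
  exact exists_four_classes_of_point (family81517_hab' hm hq hr hq_eq hr_eq)
    (by omega) hpt h1 h2 h3

/-- **K_F1, rank conjunct (p2 GEN 13 door (F*)).** For primes `m, q = m + 64n², r = m + 289n²` (`n ≠ 0`)
the curve `E : y² = x³ − 17q x² + 16 q r x` has Mordell–Weil rank at least `2`: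
`2 ≤ rank_ℤ E(ℚ)` — by `#α(E(ℚ)) ≥ 4` (`T`, `P₁ = (q, 60nq)`), `#α(E'(ℚ)) ≥ 4` (`T'`, `Q₁ = (−25q, 600nq)`)
and `#α · #α' = 2^{rank+2}`. [folklore: Silverman–Tate §3.6 applied to p2's family] -/
theorem two_le_mordellWeilRank_family81517 (hm : m.Prime) (hq : q.Prime) (hr : r.Prime) (hn : n ≠ 0)
    (hq_eq : (q : ℤ) = m + 64 * n ^ 2) (hr_eq : (r : ℤ) = m + 289 * n ^ 2) :
    2 ≤ (⟨0, ((-17 * q : ℤ) : ℚ), 0, ((16 * q * r : ℤ) : ℚ), 0⟩ : WeierstrassCurve ℚ).mordellWeilRank := by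
  haveI := isElliptic_mk_of_ne_zero (F := ℚ) (family81517_hab hm hq hr hq_eq hr_eq)
  obtain ⟨S, hS, hS4⟩ := family81517_four_classes hm hq hr hn hq_eq hr_eq
  obtain ⟨S', hS', hS4'⟩ := family81517_four_classes' hm hq hr hn hq_eq hr_eq
  rw [← family81517_codomain hq_eq hr_eq] at hS'
  exact two_le_mordellWeilRank_of_four_classes _ hS hS' hS4.ge hS4'.ge

/-- `E_{−17q,16qr}` is an elliptic curve (`Δ = 16 b²(a² − 4b) ≠ 0`). [folklore] -/
theorem isElliptic_family81517 (hm : m.Prime) (hq : q.Prime) (hr : r.Prime)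
    (hq_eq : (q : ℤ) = m + 64 * n ^ 2) (hr_eq : (r : ℤ) = m + 289 * n ^ 2) :
    (⟨0, ((-17 * q : ℤ) : ℚ), 0, ((16 * q * r : ℤ) : ℚ), 0⟩ : WeierstrassCurve ℚ).IsElliptic :=
  isElliptic_mk_of_ne_zero (F := ℚ) (family81517_hab hm hq hr hq_eq hr_eq)

end Family81517

/-! ### §3 (appendix) Transport to the `a₁ = 1` model used by p2's sketch

p2's `curve j n` is `Y² + XY = X³ + A X² + q r X` with `4A = −17q − 1` (`q ≡ 3 (mod 4)`), i.e. the image of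
`E_{−17q,16qr}` under the admissible change of variables `x = 4X`, `y = 8Y + 4X` (`u = 2`, `r = 0`, `s = 1`,
`t = 0`); the Mordell–Weil rank is invariant (tree theorem `mordellWeilRank_variableChange_holds`,
Silverman *AEC* III.3.1(b)). -/

section Model

variable {m q r : ℕ} {n : ℤ}

/-- The change of variables `(u, r, s, t) = (2, 0, 1, 0)` carries `E_{−17q,16qr}` to the `a₁ = 1` model
`⟨1, A, 0, qr, 0⟩`, `4A = −17q − 1`. [folklore] -/
theorem variableChange_family81517 {A : ℤ} (hA : 4 * A = -17 * q - 1) :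
    (⟨Units.mk0 (2 : ℚ) two_ne_zero, 0, 1, 0⟩ : VariableChange ℚ) •
        (⟨0, ((-17 * q : ℤ) : ℚ), 0, ((16 * q * r : ℤ) : ℚ), 0⟩ : WeierstrassCurve ℚ) =
      ⟨1, (A : ℚ), 0, (((q : ℤ) * r : ℤ) : ℚ), 0⟩ := by
  have hA' : (A : ℚ) = (((-17 * q - 1 : ℤ)) : ℚ) / 4 := by
    rw [eq_div_iff (by norm_num)]
    exact_mod_cast (by linarith : (A : ℤ) * 4 = -17 * q - 1)
  rw [variableChange_def]
  ext <;> simp only [Units.val_inv_eq_inv_val, Units.val_mk0] <;> push_cast at hA' ⊢ <;>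
    (try rw [hA']) <;> ring

/-- **K_F1, rank conjunct, for the `a₁ = 1` model** `Y² + XY = X³ + A X² + q r X` (`4A = −17q − 1`;
p2's `curve j n` with `m = 8j + 3`): `2 ≤ rank`. [folklore: Silverman–Tate §3.6 + AEC III.3.1(b)] -/
theorem two_le_mordellWeilRank_family81517_model (hm : m.Prime) (hq : q.Prime) (hr : r.Prime)
    (hn : n ≠ 0) (hq_eq : (q : ℤ) = m + 64 * n ^ 2) (hr_eq : (r : ℤ) = m + 289 * n ^ 2) {A : ℤ}
    (hA : 4 * A = -17 * q - 1) :
    2 ≤ (⟨1, (A : ℚ), 0, (((q : ℤ) * r : ℤ) : ℚ), 0⟩ : WeierstrassCurve ℚ).mordellWeilRank := by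
  have key := two_le_mordellWeilRank_family81517 hm hq hr hn hq_eq hr_eq
  set C : VariableChange ℚ := ⟨Units.mk0 (2 : ℚ) two_ne_zero, 0, 1, 0⟩ with hC
  set E : WeierstrassCurve ℚ := ⟨0, ((-17 * q : ℤ) : ℚ), 0, ((16 * q * r : ℤ) : ℚ), 0⟩ with hE
  have hinv : (C • E).mordellWeilRank = E.mordellWeilRank := mordellWeilRank_variableChange_holds E C
  rw [hC, hE, variableChange_family81517 hA] at hinv
  rw [hinv]
  exact key

/-- The `a₁ = 1` model is an elliptic curve. [folklore] -/
theorem isElliptic_family81517_model (hm : m.Prime) (hq : q.Prime) (hr : r.Prime)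
    (hq_eq : (q : ℤ) = m + 64 * n ^ 2) (hr_eq : (r : ℤ) = m + 289 * n ^ 2) {A : ℤ}
    (hA : 4 * A = -17 * q - 1) :
    (⟨1, (A : ℚ), 0, (((q : ℤ) * r : ℤ) : ℚ), 0⟩ : WeierstrassCurve ℚ).IsElliptic := by
  haveI := isElliptic_family81517 (n := n) hm hq hr hq_eq hr_eq
  rw [← variableChange_family81517 (r := r) hA]
  infer_instance

end Model

end Summit.BirchSwinnertonDyer.Rank2
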